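import Mathlib
import Literature.Geometry.Symplectic.JRotationBranchSolve
import HarnessLib

/-!
# Regularity of the rotated branch (Wendl 2020, App. B, Lemmas B.31 and B.35): `C¹` dependence

Continuation of `Literature/Geometry/Symplectic/JRotationBranchSolve.lean`. There, for
`0 < |s| < ε₀`, Wendl's equation (B.20) for the rotated branch was solved by the unique fixed point
`sol s = (θ(s), η(s))` of the `½`-contraction `T_s` in the box
`|θ - ε̄ s| ≤ |s|^{k+2}`, `|η| ≤ (2C_u + 1)|s|^{k+1}`. Here we prove that `s ↦ sol s` is `C¹` on
the punctured disc (`contDiffAt_sol`): the fixed point lies in the INNER half of the box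
(`sol_mem_innerBox`), hence depends continuously on `s` (`continuousAt_sol`), and the implicit
function theorem (`ContDiffAt.implicitFunction`, applied to `(s, v) ↦ v - T_s v`, whose partial
derivative `𝟙 - D_vT_s` is invertible because `‖D_vT_s‖ ≤ ½`) identifies it locally with a `C¹`
implicit function. This is the regularity part of Wendl 2020, Lemma B.35 ("`θ` and `η` are of
class `C¹`"), in the fixed-point formulation. Brick B3d (part D3) of the blueprint for
`Literature.Geometry.Symplectic.jHolomorphic_localBranchDichotomy`.

Everything is proved; no named facts.

## References

* C. Wendl, *Lectures on Contact 3-Manifolds, Holomorphic Curves and Intersection Theory*,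
  Cambridge Tracts in Math. 220 (2020), App. B, Lemmas B.31 and B.35. [Wendl2020]
* M. Micallef, B. White, *The structure of branch points in minimal surfaces and in
  pseudoholomorphic curves*, Ann. of Math. 141 (1995), §6. [MicallefWhite1995]
-/

noncomputable section

open scoped Topology ContDiff NNReal
open Set Filter Metric Function Complex

namespace Literature.Geometry.Symplectic.RotationBranch

open Literature.Analysis.Complex.KthRootChart

variable {k : ℕ} {εb : ℂ} {uh : ℂ → ℂ} {X : ℂ × ℂ → ℂ →L[ℝ] ℂ × ℂ}

/-! ### R0. Lipschitz bound for `û` from the derivative bound -/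

/-- `|û w - û w'| ≤ C_u (2r)^k |w - w'|` on `|w|, |w'| ≤ 2r` from `‖Dû(w)‖ ≤ C_u |w|^k`.
[folklore] -/
theorem lipschitz_uh_of_fderiv {Cu ρ₁ : ℝ} (hCu : 0 ≤ Cu) (hu1 : DifferentiableOn ℝ uh (ball 0 ρ₁))
    (hDu : ∀ w ∈ ball (0 : ℂ) ρ₁, ‖fderiv ℝ uh w‖ ≤ Cu * ‖w‖ ^ k) (r : ℝ) (hr : 4 * r < ρ₁) :
    ∀ w ∈ closedBall (0 : ℂ) (2 * r), ∀ w' ∈ closedBall (0 : ℂ) (2 * r),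
      ‖uh w - uh w'‖ ≤ Cu * (2 * r) ^ k * ‖w - w'‖ := by
  intro w hw w' hw'
  rcases lt_or_ge r 0 with hr0 | hr0
  · have : closedBall (0 : ℂ) (2 * r) = ∅ := closedBall_eq_empty.2 (by linarith)
    rw [this] at hw; exact absurd hw (notMem_empty _)
  have hsub : closedBall (0 : ℂ) (2 * r) ⊆ ball 0 ρ₁ := closedBall_subset_ball (by linarith)
  have hdiff : ∀ x ∈ closedBall (0 : ℂ) (2 * r), DifferentiableAt ℝ uh x := fun x hx =>
    hu1.differentiableAt (isOpen_ball.mem_nhds (hsub hx))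
  have hbound : ∀ x ∈ closedBall (0 : ℂ) (2 * r), ‖fderiv ℝ uh x‖ ≤ Cu * (2 * r) ^ k := by
    intro x hx
    have hx' : ‖x‖ ≤ 2 * r := by simpa using hx
    exact (hDu x (hsub hx)).trans (by gcongr)
  have := (convex_closedBall (0 : ℂ) (2 * r)).norm_image_sub_le_of_norm_fderiv_le (𝕜 := ℝ)
    hdiff hbound hw' hw
  simpa using this

/-! ### R1. The fixed point lies in the inner half of the box -/

/-- `T_s` maps the box into its inner half (under smallness conditions with an extra factor `½`).
[cite: Wendl2020, App. B, Lemmas B.31–B.35] -/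
theorem mapsTo_innerBox {Cu ρ₁ CX δX L δ : ℝ} (hCu : 0 ≤ Cu) (hCX : 0 ≤ CX) (hL : 0 ≤ L)
    (hu0 : ∀ w ∈ ball (0 : ℂ) ρ₁, ‖uh w‖ ≤ Cu * ‖w‖ ^ (k + 1))
    (huL : ∀ r : ℝ, 4 * r < ρ₁ → ∀ w ∈ closedBall (0 : ℂ) (2 * r), ∀ w' ∈ closedBall (0 : ℂ) (2 * r),
      ‖uh w - uh w'‖ ≤ Cu * (2 * r) ^ k * ‖w - w'‖)
    (hX1 : ∀ x ∈ closedBall (0 : ℂ × ℂ) δX, ∀ w, ‖X x w - (0, w)‖ ≤ CX * ‖x.2‖ * ‖w‖)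
    (hLip : ∀ w ∈ ball (1 : ℂ) δ, ∀ w' ∈ ball (1 : ℂ) δ, ‖kroot k w - kroot k w'‖ ≤ L * ‖w - w'‖)
    (hεn : ‖εb‖ = 1) {s : ℂ} (hs : s ≠ 0) (hr1 : ‖s‖ ≤ 1 / 2) (hrρ : 4 * ‖s‖ < ρ₁)
    (hrδ1 : (2 * ‖s‖) ^ k ≤ δX) (hrδ2 : Cu * (2 * ‖s‖) ^ (k + 1) ≤ δX)
    (hS4 : CX * (Cu * (2 * ‖s‖) ^ (k + 1)) * ((2 * Cu + 1) * ‖s‖ ^ (k + 1)) < δ * ‖s‖ ^ k)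
    (hS5 : L * ‖s‖ * (CX * (Cu * (2 * ‖s‖) ^ (k + 1)) * ((2 * Cu + 1) * ‖s‖ ^ (k + 1))) ≤
      ‖s‖ ^ (k + 2) / 2 * ‖s‖ ^ k)
    (hS6 : Cu * (2 * ‖s‖) ^ k * ‖s‖ ^ (k + 2) +
      CX * (Cu * (2 * ‖s‖) ^ (k + 1)) * ((2 * Cu + 1) * ‖s‖ ^ (k + 1)) ≤ ‖s‖ ^ (k + 1) / 2)
    {v : ℂ × ℂ} (hv : v ∈ box k εb (2 * Cu + 1) s) :
    ‖(Tmap k εb uh X s v).1 - εb * s‖ ≤ ‖s‖ ^ (k + 2) / 2 ∧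
      ‖(Tmap k εb uh X s v).2‖ ≤ (2 * Cu + 1 / 2) * ‖s‖ ^ (k + 1) := by
  set r : ℝ := ‖s‖ with hr
  set b : ℝ := 2 * Cu + 1 with hb
  set A : ℝ := CX * (Cu * (2 * r) ^ (k + 1)) * (b * r ^ (k + 1)) with hA
  obtain ⟨hθup, -, -, -, -, ha, hX2η⟩ := box_pointwise hCu hCX hu0 hX1 hεn hr1 hrρ hrδ1 hrδ2 hv
  obtain ⟨hθ, hη⟩ := mem_box.1 hv
  have hr0 : 0 < r := norm_pos_iff.2 hs
  have hrk : 0 < r ^ k := pow_pos hr0 k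
  have hεs : ‖εb * s‖ = r := by rw [norm_mul, hεn, one_mul]
  constructor
  · show ‖root k εb s (X (pt k uh v.1) v.2).1 - εb * s‖ ≤ r ^ (k + 2) / 2
    have ha' : ‖(X (pt k uh v.1) v.2).1‖ < δ * r ^ k := ha.trans_lt hS4
    have h0 : ‖(0 : ℂ)‖ < δ * r ^ k := by
      rw [norm_zero]; exact (le_trans (by positivity) ha).trans_lt hS4
    have h := norm_root_sub_root_le hLip hεn hs ha' h0
    rw [root_zero k εb hs, sub_zero] at h
    have h2 : ‖root k εb s (X (pt k uh v.1) v.2).1 - εb * s‖ * r ^ k ≤ r ^ (k + 2) / 2 * r ^ k :=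
      h.trans ((mul_le_mul_of_nonneg_left ha (by positivity)).trans hS5)
    exact le_of_mul_le_mul_right h2 hrk
  · show ‖uh s - uh v.1 - ((X (pt k uh v.1) v.2).2 - v.2)‖ ≤ (2 * Cu + 1 / 2) * r ^ (k + 1)
    have hsball : s ∈ ball (0 : ℂ) ρ₁ := by rw [mem_ball, dist_zero_right]; linarith
    have hεsball : εb * s ∈ ball (0 : ℂ) ρ₁ := by rw [mem_ball, dist_zero_right, hεs]; linarith
    have hus : ‖uh s‖ ≤ Cu * r ^ (k + 1) := hu0 s hsball
    have huεs : ‖uh (εb * s)‖ ≤ Cu * r ^ (k + 1) := by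
      have := hu0 _ hεsball; rwa [hεs] at this
    have hLipu : ‖uh (εb * s) - uh v.1‖ ≤ Cu * (2 * r) ^ k * r ^ (k + 2) := by
      have h1 : εb * s ∈ closedBall (0 : ℂ) (2 * r) := by
        rw [mem_closedBall, dist_zero_right, hεs]; linarith
      have h2 : v.1 ∈ closedBall (0 : ℂ) (2 * r) := by
        rw [mem_closedBall, dist_zero_right]; exact hθup
      calc ‖uh (εb * s) - uh v.1‖ ≤ Cu * (2 * r) ^ k * ‖εb * s - v.1‖ := huL r hrρ _ h1 _ h2
        _ ≤ Cu * (2 * r) ^ k * r ^ (k + 2) := by gcongr; rwa [norm_sub_rev]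
    calc ‖uh s - uh v.1 - ((X (pt k uh v.1) v.2).2 - v.2)‖
        ≤ ‖uh s‖ + ‖uh v.1‖ + ‖(X (pt k uh v.1) v.2).2 - v.2‖ := by
          refine (norm_sub_le _ _).trans ?_; gcongr; exact norm_sub_le _ _
      _ ≤ Cu * r ^ (k + 1) + (Cu * r ^ (k + 1) + Cu * (2 * r) ^ k * r ^ (k + 2)) + A := by
          gcongr
          calc ‖uh v.1‖ = ‖uh (εb * s) - (uh (εb * s) - uh v.1)‖ := by rw [sub_sub_cancel]
            _ ≤ ‖uh (εb * s)‖ + ‖uh (εb * s) - uh v.1‖ := norm_sub_le _ _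
            _ ≤ _ := add_le_add huεs hLipu
      _ = 2 * Cu * r ^ (k + 1) + (Cu * (2 * r) ^ k * r ^ (k + 2) + A) := by ring
      _ ≤ 2 * Cu * r ^ (k + 1) + r ^ (k + 1) / 2 := by gcongr
      _ = (2 * Cu + 1 / 2) * r ^ (k + 1) := by ring

/-- The strengthened smallness conditions hold for `0 < |s| < ε₀'`. [folklore] -/
theorem exists_eps_small' (hk : k ≠ 0) {Cu ρ₁ CX δX L δ : ℝ} (hCu : 0 ≤ Cu) (hCX : 0 ≤ CX)
    (hρ₁ : 0 < ρ₁) (hδX : 0 < δX) (hδ : 0 < δ) :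
    ∃ ε₀ : ℝ, 0 < ε₀ ∧ ∀ s : ℂ, s ≠ 0 → ‖s‖ < ε₀ →
      ‖s‖ ≤ 1 / 2 ∧ 4 * ‖s‖ < ρ₁ ∧ (2 * ‖s‖) ^ k ≤ δX ∧ Cu * (2 * ‖s‖) ^ (k + 1) ≤ δX ∧
      CX * (Cu * (2 * ‖s‖) ^ (k + 1)) * ((2 * Cu + 1) * ‖s‖ ^ (k + 1)) < δ * ‖s‖ ^ k ∧
      L * ‖s‖ * (CX * (Cu * (2 * ‖s‖) ^ (k + 1)) * ((2 * Cu + 1) * ‖s‖ ^ (k + 1))) ≤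
        ‖s‖ ^ (k + 2) / 2 * ‖s‖ ^ k ∧
      Cu * (2 * ‖s‖) ^ k * ‖s‖ ^ (k + 2) +
        CX * (Cu * (2 * ‖s‖) ^ (k + 1)) * ((2 * Cu + 1) * ‖s‖ ^ (k + 1)) ≤ ‖s‖ ^ (k + 1) / 2 := by
  set K₄ : ℝ := CX * Cu * 2 ^ (k + 1) * (2 * Cu + 1) with hK₄
  have hK₄0 : 0 ≤ K₄ := by positivity
  set f₁ : ℝ → ℝ := fun r => (2 * r) ^ k with hf₁
  set f₂ : ℝ → ℝ := fun r => Cu * (2 * r) ^ (k + 1) with hf₂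
  set f₄ : ℝ → ℝ := fun r => K₄ * r ^ (k + 2) with hf₄
  set f₅ : ℝ → ℝ := fun r => L * K₄ * r with hf₅
  set f₆ : ℝ → ℝ := fun r => Cu * 2 ^ k * r ^ (k + 1) + K₄ * r ^ (k + 1) with hf₆
  have ev : ∀ {f : ℝ → ℝ} {c : ℝ}, Continuous f → f 0 < c → ∀ᶠ r in 𝓝 (0 : ℝ), f r < c :=
    fun hf h0 => (hf.tendsto 0).eventually_lt_const h0
  have e₀ : ∀ᶠ r in 𝓝 (0 : ℝ), r < min (1 / 2) (ρ₁ / 4) := ev continuous_id (by simp [hρ₁])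
  have e₁ : ∀ᶠ r in 𝓝 (0 : ℝ), f₁ r < δX := ev (by fun_prop) (by simp [hf₁, hk, hδX])
  have e₂ : ∀ᶠ r in 𝓝 (0 : ℝ), f₂ r < δX := ev (by fun_prop) (by simp [hf₂, hδX])
  have e₄ : ∀ᶠ r in 𝓝 (0 : ℝ), f₄ r < δ := ev (by fun_prop) (by simp [hf₄, hδ])
  have e₅ : ∀ᶠ r in 𝓝 (0 : ℝ), f₅ r < 1 / 2 := ev (by fun_prop) (by simp [hf₅])
  have e₆ : ∀ᶠ r in 𝓝 (0 : ℝ), f₆ r < 1 / 2 := ev (by fun_prop) (by simp [hf₆])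
  obtain ⟨ε₀, hε₀, hall⟩ := Metric.eventually_nhds_iff.1 (e₀.and (e₁.and (e₂.and (e₄.and (e₅.and e₆)))))
  refine ⟨ε₀, hε₀, fun s hs hsε => ?_⟩
  set r : ℝ := ‖s‖ with hr
  have hr0 : 0 < r := norm_pos_iff.2 hs
  have hrk : 0 < r ^ k := pow_pos hr0 k
  obtain ⟨h₀, h₁, h₂, h₄, h₅, h₆⟩ := hall (y := r) (by simpa [hr] using hsε)
  have hr12 : r ≤ 1 / 2 := (h₀.trans_le (min_le_left _ _)).le
  have hrρ : 4 * r < ρ₁ := by linarith [h₀.trans_le (min_le_right _ _)]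
  have hA : CX * (Cu * (2 * r) ^ (k + 1)) * ((2 * Cu + 1) * r ^ (k + 1)) =
      K₄ * r ^ (k + 1) * r ^ (k + 1) := by rw [hK₄]; ring
  refine ⟨hr12, hrρ, h₁.le, h₂.le, ?_, ?_, ?_⟩
  · rw [hA]
    calc K₄ * r ^ (k + 1) * r ^ (k + 1) = (K₄ * r ^ (k + 2)) * r ^ k := by ring
      _ < δ * r ^ k := by gcongr
  · rw [hA]
    calc L * r * (K₄ * r ^ (k + 1) * r ^ (k + 1)) = (L * K₄ * r) * (r ^ (k + 2) * r ^ k) := by ring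
      _ ≤ 1 / 2 * (r ^ (k + 2) * r ^ k) := by gcongr
      _ = r ^ (k + 2) / 2 * r ^ k := by ring
  · rw [hA]
    calc Cu * (2 * r) ^ k * r ^ (k + 2) + K₄ * r ^ (k + 1) * r ^ (k + 1)
        = (Cu * 2 ^ k * r ^ (k + 1) + K₄ * r ^ (k + 1)) * r ^ (k + 1) := by ring
      _ ≤ 1 / 2 * r ^ (k + 1) := by gcongr
      _ = r ^ (k + 1) / 2 := by ring

/-! ### R2. Joint `C¹` regularity of `(s, v) ↦ T_s v` -/

/-- `(s, v) ↦ T_s v` is `C¹` at `(s, v)` when `s ≠ 0`, `|X̌_{v.2}(p v.1)| < |s|ᵏ`, `û` is `C¹`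
near `s` and `v.1`, and `X` is `C¹` near `p(v.1)`. [folklore] -/
theorem contDiffAt_Tmap {V : Set (ℂ × ℂ)} (hV : IsOpen V) (hX : ContDiffOn ℝ 1 X V) {ρ₁ : ℝ}
    (hu1 : ContDiffOn ℝ 1 uh (ball 0 ρ₁)) {s : ℂ} {v : ℂ × ℂ} (hs : s ≠ 0)
    (hsρ : s ∈ ball (0 : ℂ) ρ₁) (hvρ : v.1 ∈ ball (0 : ℂ) ρ₁) (hpV : pt k uh v.1 ∈ V)
    (ha : ‖(X (pt k uh v.1) v.2).1‖ < ‖s‖ ^ k) :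
    ContDiffAt ℝ 1 (fun q : ℂ × (ℂ × ℂ) => Tmap k εb uh X q.1 q.2) (s, v) := by
  -- the building blocks
  have hpt : ContDiffAt ℝ 1 (fun q : ℂ × (ℂ × ℂ) => pt k uh q.2.1) (s, v) := by
    have h1 : ContDiffAt ℝ 1 (fun q : ℂ × (ℂ × ℂ) => q.2.1) (s, v) := contDiffAt_fst.comp _ contDiffAt_snd
    have hu : ContDiffAt ℝ 1 uh v.1 := hu1.contDiffAt (isOpen_ball.mem_nhds hvρ)
    exact (h1.pow k).prodMk (hu.comp (s, v) h1)
  have hXp : ContDiffAt ℝ 1 (fun q : ℂ × (ℂ × ℂ) => X (pt k uh q.2.1)) (s, v) :=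
    (hX.contDiffAt (hV.mem_nhds hpV)).comp (s, v) hpt
  have hXpη : ContDiffAt ℝ 1 (fun q : ℂ × (ℂ × ℂ) => X (pt k uh q.2.1) q.2.2) (s, v) :=
    hXp.clm_apply (contDiffAt_snd.comp _ contDiffAt_snd)
  have ha' : ContDiffAt ℝ 1 (fun q : ℂ × (ℂ × ℂ) => (X (pt k uh q.2.1) q.2.2).1) (s, v) :=
    contDiffAt_fst.comp _ hXpη
  have hb' : ContDiffAt ℝ 1 (fun q : ℂ × (ℂ × ℂ) => (X (pt k uh q.2.1) q.2.2).2) (s, v) :=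
    contDiffAt_snd.comp _ hXpη
  -- the root component
  have hsk : s ^ k ≠ 0 := pow_ne_zero k hs
  have hpow : ContDiffAt ℝ 1 (fun q : ℂ × (ℂ × ℂ) => q.1 ^ k) (s, v) := contDiffAt_fst.pow k
  have hw : ContDiffAt ℝ 1 (fun q : ℂ × (ℂ × ℂ) => (q.1 ^ k - (X (pt k uh q.2.1) q.2.2).1) / q.1 ^ k)
      (s, v) := by
    have hinv : ContDiffAt ℝ 1 (fun q : ℂ × (ℂ × ℂ) => (q.1 ^ k)⁻¹) (s, v) :=
      hpow.inv (show (fun q : ℂ × (ℂ × ℂ) => q.1 ^ k) (s, v) ≠ 0 from hsk)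
    simpa only [div_eq_mul_inv] using (hpow.sub ha').mul hinv
  have hmem : (s ^ k - (X (pt k uh v.1) v.2).1) / s ^ k ∈ slitPlane := by
    apply Complex.ball_one_subset_slitPlane
    rw [mem_ball, dist_eq_norm, sub_div, div_self hsk, sub_sub_cancel_left, norm_neg, norm_div,
      norm_pow, div_lt_one (by positivity)]
    exact ha
  have hroot : ContDiffAt ℝ 1 (fun q : ℂ × (ℂ × ℂ) => root k εb q.1 (X (pt k uh q.2.1) q.2.2).1)
      (s, v) := by
    have hkr0 : ContDiffAt ℝ 1 (kroot k) ((s ^ k - (X (pt k uh v.1) v.2).1) / s ^ k) :=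
      contDiffAt_kthRoot k hmem
    have hkr : ContDiffAt ℝ 1 ((kroot k) ∘ fun q : ℂ × (ℂ × ℂ) =>
        (q.1 ^ k - (X (pt k uh q.2.1) q.2.2).1) / q.1 ^ k) (s, v) :=
      hkr0.comp (s, v) hw
    exact ((contDiffAt_const.mul contDiffAt_fst).mul hkr :)
  -- the normal component
  have hus : ContDiffAt ℝ 1 (fun q : ℂ × (ℂ × ℂ) => uh q.1) (s, v) :=
    (hu1.contDiffAt (isOpen_ball.mem_nhds hsρ)).comp (s, v) contDiffAt_fst
  have huθ : ContDiffAt ℝ 1 (fun q : ℂ × (ℂ × ℂ) => uh q.2.1) (s, v) :=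
    (hu1.contDiffAt (isOpen_ball.mem_nhds hvρ)).comp (s, v) (contDiffAt_fst.comp _ contDiffAt_snd)
  have hη : ContDiffAt ℝ 1 (fun q : ℂ × (ℂ × ℂ) => q.2.2) (s, v) := contDiffAt_snd.comp _ contDiffAt_snd
  exact hroot.prodMk ((hus.sub huθ).sub (hb'.sub hη))

/-- Continuity in `s` alone. [folklore] -/
theorem continuousAt_Tmap_left {V : Set (ℂ × ℂ)} (hV : IsOpen V) (hX : ContDiffOn ℝ 1 X V) {ρ₁ : ℝ}
    (hu1 : ContDiffOn ℝ 1 uh (ball 0 ρ₁)) {s : ℂ} {v : ℂ × ℂ} (hs : s ≠ 0)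
    (hsρ : s ∈ ball (0 : ℂ) ρ₁) (hvρ : v.1 ∈ ball (0 : ℂ) ρ₁) (hpV : pt k uh v.1 ∈ V)
    (ha : ‖(X (pt k uh v.1) v.2).1‖ < ‖s‖ ^ k) :
    ContinuousAt (fun s' : ℂ => Tmap k εb uh X s' v) s := by
  have h := (contDiffAt_Tmap (εb := εb) hV hX hu1 hs hsρ hvρ hpV ha).continuousAt
  have hg : ContinuousAt (fun s' : ℂ => ((s', v) : ℂ × (ℂ × ℂ))) s :=
    continuousAt_id.prodMk continuousAt_const
  exact ContinuousAt.comp (f := fun s' : ℂ => ((s', v) : ℂ × (ℂ × ℂ))) (x := s) h hg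


/-! ### R3. The solution map and its `C¹` regularity -/

open Classical in
/-- The solution map: the fixed point of `T_s` in the box with constant `b` (junk `(ε̄ s, 0)` if
there is none). [cite: Wendl2020, App. B, Lemma B.35] -/
def sol (k : ℕ) (εb : ℂ) (uh : ℂ → ℂ) (X : ℂ × ℂ → ℂ →L[ℝ] ℂ × ℂ) (b : ℝ) (s : ℂ) : ℂ × ℂ :=
  if h : ∃ v ∈ box k εb b s, Tmap k εb uh X s v = v then h.choose else (εb * s, 0)

/-- The defining property of `sol`. [folklore] -/
theorem sol_spec {b : ℝ} {s : ℂ} (h : ∃ v ∈ box k εb b s, Tmap k εb uh X s v = v) :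
    sol k εb uh X b s ∈ box k εb b s ∧ Tmap k εb uh X s (sol k εb uh X b s) = sol k εb uh X b s := by
  have : sol k εb uh X b s = h.choose := by
    unfold sol; rw [dif_pos h]
  rw [this]; exact h.choose_spec

/-- `𝟙 - B` is invertible when `‖B‖ < 1`. [folklore] -/
theorem isInvertible_id_sub {E : Type*} [NormedAddCommGroup E] [NormedSpace ℝ E] [CompleteSpace E]
    {B : E →L[ℝ] E} (hB : ‖B‖ < 1) : (ContinuousLinearMap.id ℝ E - B).IsInvertible := by
  set w := Units.oneSub B hB with hw
  have hval : (w : E →L[ℝ] E) = ContinuousLinearMap.id ℝ E - B := by rw [hw, Units.val_oneSub]; rfl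
  refine ContinuousLinearMap.IsInvertible.of_inverse (g := ((w⁻¹ : (E →L[ℝ] E)ˣ) : E →L[ℝ] E)) ?_ ?_
  · rw [← hval]; exact w.mul_inv
  · rw [← hval]; exact w.inv_mul

/-- **`C¹` regularity of the rotated branch** (Wendl 2020, Lemma B.35, regularity part, in the
fixed-point formulation). Under the hypotheses of `exists_branchSolution` with `û ∈ C¹`,
`‖Dû(w)‖ ≤ C_u|w|ᵏ` and `X ∈ C¹` near the closed ball: for `0 < |s| < ε₁` the solution
`sol s = (θ(s), η(s))` is the fixed point of `T_s` in the box, lies in its inner half, solves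
(B.20), and `s ↦ sol s` is `C¹` at `s`; moreover `T_s` is a `½`-contraction on the box, which is
a neighbourhood of `sol s`. [cite: Wendl2020, App. B, Lemmas B.31 and B.35] -/
theorem exists_regular_branch (hk : k ≠ 0) (hε : εb ^ k = 1) (hεn : ‖εb‖ = 1)
    {Cu ρ₁ CX δX : ℝ} (hCu : 0 ≤ Cu) (hCX : 0 ≤ CX) (hρ₁ : 0 < ρ₁) (hδX : 0 < δX)
    {V : Set (ℂ × ℂ)} (hV : IsOpen V) (hKV : closedBall (0 : ℂ × ℂ) δX ⊆ V)
    (hX : ContDiffOn ℝ 1 X V) (hu1 : ContDiffOn ℝ 1 uh (ball 0 ρ₁))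
    (hu0 : ∀ w ∈ ball (0 : ℂ) ρ₁, ‖uh w‖ ≤ Cu * ‖w‖ ^ (k + 1))
    (hDu : ∀ w ∈ ball (0 : ℂ) ρ₁, ‖fderiv ℝ uh w‖ ≤ Cu * ‖w‖ ^ k)
    (hX1 : ∀ x ∈ closedBall (0 : ℂ × ℂ) δX, ∀ w, ‖X x w - (0, w)‖ ≤ CX * ‖x.2‖ * ‖w‖)
    (hX2 : ∀ x ∈ closedBall (0 : ℂ × ℂ) δX, ∀ x' ∈ closedBall (0 : ℂ × ℂ) δX, ∀ w,
      ‖X x w - X x' w‖ ≤ CX * ‖x - x'‖ * ‖w‖) :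
    ∃ ε₁ : ℝ, 0 < ε₁ ∧ ∀ s : ℂ, s ≠ 0 → ‖s‖ < ε₁ →
      ‖s‖ ≤ 1 / 2 ∧ 4 * ‖s‖ < ρ₁ ∧ (2 * ‖s‖) ^ k ≤ δX ∧ Cu * (2 * ‖s‖) ^ (k + 1) ≤ δX ∧
      sol k εb uh X (2 * Cu + 1) s ∈ box k εb (2 * Cu + 1) s ∧
      Tmap k εb uh X s (sol k εb uh X (2 * Cu + 1) s) = sol k εb uh X (2 * Cu + 1) s ∧
      ‖(sol k εb uh X (2 * Cu + 1) s).1 - εb * s‖ ≤ ‖s‖ ^ (k + 2) / 2 ∧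
      ‖(sol k εb uh X (2 * Cu + 1) s).2‖ ≤ (2 * Cu + 1 / 2) * ‖s‖ ^ (k + 1) ∧
      ((sol k εb uh X (2 * Cu + 1) s).1 ^ k +
          (X (pt k uh (sol k εb uh X (2 * Cu + 1) s).1) (sol k εb uh X (2 * Cu + 1) s).2).1 = s ^ k ∧
        uh (sol k εb uh X (2 * Cu + 1) s).1 +
          (X (pt k uh (sol k εb uh X (2 * Cu + 1) s).1) (sol k εb uh X (2 * Cu + 1) s).2).2 = uh s) ∧
      (∀ v ∈ box k εb (2 * Cu + 1) s, ∀ v' ∈ box k εb (2 * Cu + 1) s,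
        dist (Tmap k εb uh X s v) (Tmap k εb uh X s v') ≤ dist v v' / 2) ∧
      box k εb (2 * Cu + 1) s ∈ 𝓝 (sol k εb uh X (2 * Cu + 1) s) ∧
      ‖(X (pt k uh (sol k εb uh X (2 * Cu + 1) s).1) (sol k εb uh X (2 * Cu + 1) s).2).1‖ < ‖s‖ ^ k ∧
      ContDiffAt ℝ 1 (sol k εb uh X (2 * Cu + 1)) s := by
  have huL := lipschitz_uh_of_fderiv (k := k) hCu (hu1.differentiableOn one_ne_zero) hDu
  obtain ⟨ε₀, hε₀, hsolve⟩ := exists_branchSolution hk hε hεn hCu hCX hρ₁ hδX hu0 huL hX1 hX2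
  obtain ⟨L, δ, hL, hδ, hδ1, hLip, -⟩ := exists_kroot_lipschitz k
  obtain ⟨ε₀', hε₀', hsmall'⟩ :=
    exists_eps_small' (Cu := Cu) (CX := CX) (L := L) hk hCu hCX hρ₁ hδX hδ
  set b : ℝ := 2 * Cu + 1 with hb
  -- ### pointwise facts for every admissible `s`
  have key : ∀ s : ℂ, s ≠ 0 → ‖s‖ < min ε₀ ε₀' →
      ‖s‖ ≤ 1 / 2 ∧ 4 * ‖s‖ < ρ₁ ∧ (2 * ‖s‖) ^ k ≤ δX ∧ Cu * (2 * ‖s‖) ^ (k + 1) ≤ δX ∧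
      sol k εb uh X b s ∈ box k εb b s ∧ Tmap k εb uh X s (sol k εb uh X b s) = sol k εb uh X b s ∧
      ‖(sol k εb uh X b s).1 - εb * s‖ ≤ ‖s‖ ^ (k + 2) / 2 ∧
      ‖(sol k εb uh X b s).2‖ ≤ (2 * Cu + 1 / 2) * ‖s‖ ^ (k + 1) ∧
      ((sol k εb uh X b s).1 ^ k + (X (pt k uh (sol k εb uh X b s).1) (sol k εb uh X b s).2).1 = s ^ k ∧
        uh (sol k εb uh X b s).1 + (X (pt k uh (sol k εb uh X b s).1) (sol k εb uh X b s).2).2 = uh s) ∧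
      (∀ v ∈ box k εb b s, ∀ v' ∈ box k εb b s,
        dist (Tmap k εb uh X s v) (Tmap k εb uh X s v') ≤ dist v v' / 2) ∧
      box k εb b s ∈ 𝓝 (sol k εb uh X b s) ∧
      ‖(X (pt k uh (sol k εb uh X b s).1) (sol k εb uh X b s).2).1‖ < ‖s‖ ^ k ∧
      (sol k εb uh X b s).1 ∈ ball (0 : ℂ) ρ₁ ∧ pt k uh (sol k εb uh X b s).1 ∈ V := by
    intro s hs hsε
    obtain ⟨hr1, hrρ, hrδ1, hrδ2, -, hcontr, hex, -, heqs⟩ :=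
      hsolve s hs (hsε.trans_le (min_le_left _ _))
    obtain ⟨-, -, -, -, hS4', hS5', hS6'⟩ := hsmall' s hs (hsε.trans_le (min_le_right _ _))
    obtain ⟨hvbox, hfix⟩ := sol_spec hex
    set v := sol k εb uh X b s with hv
    have hinner := mapsTo_innerBox hCu hCX hL hu0 huL hX1 hLip hεn hs hr1 hrρ hrδ1 hrδ2 hS4' hS5' hS6'
      hvbox
    rw [hfix] at hinner
    obtain ⟨-, -, hvρ, -, hpmem, ha, -⟩ := box_pointwise hCu hCX hu0 hX1 hεn hr1 hrρ hrδ1 hrδ2 hvbox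
    have ha' : ‖(X (pt k uh v.1) v.2).1‖ < ‖s‖ ^ k :=
      (ha.trans_lt hS4').trans_le (by nlinarith [pow_pos (norm_pos_iff.2 hs) k])
    have hr0 : 0 < ‖s‖ := norm_pos_iff.2 hs
    -- the box is a neighbourhood of the fixed point
    have hnhds : box k εb b s ∈ 𝓝 v := by
      refine Metric.mem_nhds_iff.2 ⟨‖s‖ ^ (k + 2) / 2, by positivity, fun w hw => ?_⟩
      rw [mem_ball, Prod.dist_eq, max_lt_iff, dist_eq_norm, dist_eq_norm] at hw
      rw [mem_box]
      constructor
      · calc ‖w.1 - εb * s‖ = ‖(w.1 - v.1) + (v.1 - εb * s)‖ := by rw [sub_add_sub_cancel]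
          _ ≤ ‖w.1 - v.1‖ + ‖v.1 - εb * s‖ := norm_add_le _ _
          _ ≤ ‖s‖ ^ (k + 2) / 2 + ‖s‖ ^ (k + 2) / 2 := add_le_add hw.1.le hinner.1
          _ = ‖s‖ ^ (k + 2) := by ring
      · have hk12 : ‖s‖ ^ (k + 2) ≤ ‖s‖ ^ (k + 1) :=
          pow_le_pow_of_le_one hr0.le (by linarith) (by omega)
        calc ‖w.2‖ = ‖(w.2 - v.2) + v.2‖ := by rw [sub_add_cancel]
          _ ≤ ‖w.2 - v.2‖ + ‖v.2‖ := norm_add_le _ _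
          _ ≤ ‖s‖ ^ (k + 2) / 2 + (2 * Cu + 1 / 2) * ‖s‖ ^ (k + 1) := add_le_add hw.2.le hinner.2
          _ ≤ ‖s‖ ^ (k + 1) / 2 + (2 * Cu + 1 / 2) * ‖s‖ ^ (k + 1) := by linarith
          _ = b * ‖s‖ ^ (k + 1) := by rw [hb]; ring
    exact ⟨hr1, hrρ, hrδ1, hrδ2, hvbox, hfix, hinner.1, hinner.2, heqs v hvbox hfix, hcontr, hnhds, ha',
      hvρ, hKV hpmem⟩
  refine ⟨min ε₀ ε₀', lt_min hε₀ hε₀', fun s hs hsε => ?_⟩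
  obtain ⟨hr1, hrρ, hrδ1, hrδ2, hvbox, hfix, hin1, hin2, heqs, hcontr, hnhds, ha', hvρ, hpV⟩ :=
    key s hs hsε
  refine ⟨hr1, hrρ, hrδ1, hrδ2, hvbox, hfix, hin1, hin2, heqs, hcontr, hnhds, ha', ?_⟩
  -- ### `C¹` regularity via the implicit function theorem
  set v := sol k εb uh X b s with hv
  have hr0 : 0 < ‖s‖ := norm_pos_iff.2 hs
  have hsρ : s ∈ ball (0 : ℂ) ρ₁ := by rw [mem_ball, dist_zero_right]; linarith
  set Tj : ℂ × (ℂ × ℂ) → ℂ × ℂ := fun q => Tmap k εb uh X q.1 q.2 with hTj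
  have hTj : ContDiffAt ℝ 1 Tj (s, v) := contDiffAt_Tmap hV hX hu1 hs hsρ hvρ hpV ha'
  set f : ℂ × (ℂ × ℂ) → ℂ × ℂ := fun q => q.2 - Tj q with hf
  have cdf : ContDiffAt ℝ 1 f (s, v) := contDiffAt_snd.sub hTj
  -- the partial derivative in `v` is `𝟙 - D_vT`, with `‖D_vT‖ ≤ ½`
  set B : ℂ × ℂ →L[ℝ] ℂ × ℂ := fderiv ℝ (Tmap k εb uh X s) v with hB
  have hBn : ‖B‖ ≤ (1 / 2 : NNReal) := by
    have hlip : LipschitzOnWith (1 / 2 : NNReal) (Tmap k εb uh X s) (box k εb b s) := by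
      refine LipschitzOnWith.of_dist_le_mul fun x hx y hy => ?_
      have := hcontr x hx y hy
      push_cast
      linarith
    exact norm_fderiv_le_of_lipschitzOn ℝ hnhds hlip
  have hpart : fderiv ℝ f (s, v) ∘L ContinuousLinearMap.inr ℝ ℂ (ℂ × ℂ) =
      ContinuousLinearMap.id ℝ (ℂ × ℂ) - B := by
    have h1 : fderiv ℝ f (s, v) = ContinuousLinearMap.snd ℝ ℂ (ℂ × ℂ) - fderiv ℝ Tj (s, v) :=
      (hasFDerivAt_snd.sub (hTj.differentiableAt one_ne_zero).hasFDerivAt).fderiv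
    have h2 : fderiv ℝ Tj (s, v) ∘L ContinuousLinearMap.inr ℝ ℂ (ℂ × ℂ) = B := by
      have hc : HasFDerivAt (Tj ∘ fun w : ℂ × ℂ => ((s, w) : ℂ × (ℂ × ℂ)))
          (fderiv ℝ Tj (s, v) ∘L ContinuousLinearMap.inr ℝ ℂ (ℂ × ℂ)) v :=
        (hTj.differentiableAt one_ne_zero).hasFDerivAt.comp v (hasFDerivAt_prodMk_right (𝕜 := ℝ) s v)
      rw [hB, ← hc.fderiv]; rfl
    rw [h1, ContinuousLinearMap.sub_comp, h2, ContinuousLinearMap.snd_comp_inr]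
  have if₂ : (fderiv ℝ f (s, v) ∘L ContinuousLinearMap.inr ℝ ℂ (ℂ × ℂ)).IsInvertible := by
    rw [hpart]
    exact isInvertible_id_sub (hBn.trans_lt (by norm_num))
  set ψ := cdf.implicitFunction one_ne_zero if₂ with hψ
  have hψreg : ContDiffAt ℝ 1 ψ s := cdf.contDiffAt_implicitFunction one_ne_zero if₂
  have hiff := cdf.eventually_apply_eq_iff_implicitFunction one_ne_zero if₂
  -- ### continuity of the solution map at `s`
  have hfu : f (s, v) = 0 := by
    show v - Tmap k εb uh X s v = 0
    rw [hfix, sub_self]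
  have hadm : ∀ᶠ s' in 𝓝 s, s' ≠ 0 ∧ ‖s'‖ < min ε₀ ε₀' := by
    refine (isOpen_ne.inter (isOpen_lt continuous_norm continuous_const)).mem_nhds ⟨hs, hsε⟩
  have hvbox' : ∀ᶠ s' in 𝓝 s, v ∈ box k εb b s' := by
    have hg₁ : Tendsto (fun s' : ℂ => ‖s'‖ ^ (k + 2) - ‖s' - s‖) (𝓝 s) (𝓝 (‖s‖ ^ (k + 2) - ‖s - s‖)) :=
      ((continuous_norm.pow _).sub (continuous_id.sub continuous_const).norm).tendsto s
    have e₁ : ∀ᶠ s' in 𝓝 s, ‖s‖ ^ (k + 2) / 2 < ‖s'‖ ^ (k + 2) - ‖s' - s‖ :=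
      hg₁.eventually_const_lt (by simp; positivity)
    have hg₂ : Tendsto (fun s' : ℂ => b * ‖s'‖ ^ (k + 1)) (𝓝 s) (𝓝 (b * ‖s‖ ^ (k + 1))) :=
      (continuous_const.mul (continuous_norm.pow _)).tendsto s
    have e₂ : ∀ᶠ s' in 𝓝 s, (2 * Cu + 1 / 2) * ‖s‖ ^ (k + 1) < b * ‖s'‖ ^ (k + 1) :=
      hg₂.eventually_const_lt (by
        rw [hb]
        have : (0 : ℝ) < ‖s‖ ^ (k + 1) := by positivity
        nlinarith)
    filter_upwards [e₁, e₂] with s' h₁ h₂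
    rw [mem_box]
    constructor
    · have hn : ‖εb * (s - s')‖ = ‖s' - s‖ := by rw [norm_mul, hεn, one_mul, norm_sub_rev]
      calc ‖v.1 - εb * s'‖ = ‖(v.1 - εb * s) + εb * (s - s')‖ := by congr 1; ring
        _ ≤ ‖v.1 - εb * s‖ + ‖εb * (s - s')‖ := norm_add_le _ _
        _ ≤ ‖s‖ ^ (k + 2) / 2 + ‖s' - s‖ := by rw [hn]; exact add_le_add hin1 le_rfl
        _ ≤ ‖s'‖ ^ (k + 2) := by linarith
    · exact hin2.trans h₂.le
  have hcont : Tendsto (sol k εb uh X b) (𝓝 s) (𝓝 v) := by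
    have hT : ContinuousAt (fun s' : ℂ => Tmap k εb uh X s' v) s :=
      continuousAt_Tmap_left (εb := εb) hV hX hu1 hs hsρ hvρ hpV ha'
    rw [Metric.tendsto_nhds]
    intro ε hεpos
    have e₃ : ∀ᶠ s' in 𝓝 s, dist (Tmap k εb uh X s' v) (Tmap k εb uh X s v) < ε / 2 :=
      Metric.tendsto_nhds.1 hT (ε / 2) (by positivity)
    filter_upwards [hadm, hvbox', e₃] with s' h₁ h₂ h₃
    obtain ⟨-, -, -, -, hbox₁, hfix₁, -, -, -, hcontr₁, -⟩ := key s' h₁.1 h₁.2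
    have hd : dist (sol k εb uh X b s') v < dist (sol k εb uh X b s') v / 2 + ε / 2 := by
      calc dist (sol k εb uh X b s') v
          = dist (Tmap k εb uh X s' (sol k εb uh X b s')) (Tmap k εb uh X s v) := by rw [hfix₁, hfix]
        _ ≤ dist (Tmap k εb uh X s' (sol k εb uh X b s')) (Tmap k εb uh X s' v) +
            dist (Tmap k εb uh X s' v) (Tmap k εb uh X s v) := dist_triangle _ _ _
        _ < dist (sol k εb uh X b s') v / 2 + ε / 2 :=
            add_lt_add_of_le_of_lt (hcontr₁ _ hbox₁ _ h₂) h₃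
    linarith
  -- ### identification with the implicit function near `s`
  have hpair : Tendsto (fun s' : ℂ => ((s', sol k εb uh X b s') : ℂ × (ℂ × ℂ))) (𝓝 s) (𝓝 (s, v)) :=
    tendsto_id.prodMk_nhds hcont
  have hev : sol k εb uh X b =ᶠ[𝓝 s] ψ := by
    filter_upwards [hpair.eventually hiff, hadm] with s' h₁ h₂
    obtain ⟨-, -, -, -, -, hfix₁, -⟩ := key s' h₂.1 h₂.2
    have : f (s', sol k εb uh X b s') = f (s, v) := by
      rw [hfu]
      show sol k εb uh X b s' - Tmap k εb uh X s' (sol k εb uh X b s') = 0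
      rw [hfix₁, sub_self]
    exact (h₁.1 this).symm
  exact hψreg.congr_of_eventuallyEq hev


end Literature.Geometry.Symplectic.RotationBranch

end
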